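import Summits.AtomisticToContinuum.Crystallization.Theorems.FrustratedLawDichotomyStrainedPatchHomHertzKit

/-!
# Sign-vertex / PSD kit in GENERAL dimension `n` (`psdTestN`, `hertzTestN`) — the `Fin n` successor of `…HomHertz` / `…HomHertzKit` (`Fin 3`)
# (27623 `(H) HomFloor`, hcp half; hand-1 g40 head-start for g41's G5′ (critic row 1484 (C)/(E): joint `(U, ξ)` second-order value leaf ⇒ `9 × 9` / `12 × 12`
#  interval Hessians; G5PRIME-KITMAP-g41.md item N2)

* §1 `qfN n M x = Σ_ij M_ij x_i x_j` (integer array, real vector); `schurStep` (division-free Schur complement `a·M′ − m mᵀ`); `toArr/getA` array storage (DATA,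
  not closures — a closure-valued recursion is exponential in `n`, measured); ★ `psdTestA n A` / `psdTestN n M : Bool` — recursive test: (`M₀₀ > 0` ∧ test of the Schur step) ∨ (row/column 0 vanish ∧ test of the minor); ★ `qfN_nonneg_of_psdTestN` — symmetric + test ⟹ form `≥ 0`
  (induction on `n`; identity `a·q(x) = (a x₀ + Σ_j M₀ⱼ x_j)² + q_B(x′)`).
* §2 ★ `quadForm_ge_of_signVerticesN` — Rohn/Hertz sign-vertex reduction in dimension `n` (verbatim the `Fin 3` argument of `…HomHertz`).
* §3 `signsN n` (all `2ⁿ` sign vectors, `Fin.cons` recursion) + `exists_sign_castN`; `vertexArrN`, `symTestN`, ★ `hertzTestN n E W κS : Bool`;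
  ★★ `quadForm_ge_of_hertzTestN` — `M_ij ∈ E_ij`, `|P_ij|·SC ≤ W_ij`, test ⟹ `(κS/SC)·Σ x_i² ≤ Σ (M + P)_ij x_i x_j` (verbatim the `Fin 3` statement shape).

MEASURED natively (hand-1 g40 probe hz/T1): `hertzTestN 3` agrees with `hertzTest` on a DX-like interval matrix (κ = 5.0 ✓ / 5.3 ✗ / 5.6 ✗ both); 9 × 9 and
12 × 12 block examples evaluate (512 / 2048 relevant sign vertices; ≈ 15 s per 9 × 9 call, ≈ 60 s per 12 × 12 — the division-free Schur entries double in
bit-length per level; a Bareiss division or a conservative right-shift per level is the obvious optimisation if G5′ needs < 5 s).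

Kernel definitions + soundness; 0 sorry; standard axioms; no instances / notation / `#eval`.  `--supports stmt-AtomisticToContinuum-27623`.
-/

noncomputable section

namespace Summit.AtomisticToContinuum.Crystallization.Theorems.FrustratedLawDichotomyStrainedPatchHomHertzN

open scoped BigOperators
open Literature.Analysis.ValidatedNumerics.Numerics
open Summit.AtomisticToContinuum.Crystallization.Theorems.FrustratedLawDichotomyStrainedPatchHomHertz (quadForm_pert_ge)

/-! ## §1 The division-free LDLᵀ / Schur test in dimension `n` -/

/-- Quadratic form of an integer `n × n` array at a real vector. -/
def qfN (n : ℕ) (M : Fin n → Fin n → ℤ) (x : Fin n → ℝ) : ℝ := ∑ i, ∑ j, (M i j : ℝ) * (x i * x j)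

/-- Division-free Schur complement after pivot `0`: `B_ij = M₀₀·M_{i+1,j+1} − M_{i+1,0}·M_{0,j+1}`. -/
def schurStep (n : ℕ) (M : Fin (n + 1) → Fin (n + 1) → ℤ) : Fin n → Fin n → ℤ :=
  fun i j => M 0 0 * M i.succ j.succ - M i.succ 0 * M 0 j.succ

/-- The principal minor on indices `≥ 1`. -/
def minorStep (n : ℕ) (M : Fin (n + 1) → Fin (n + 1) → ℤ) : Fin n → Fin n → ℤ := fun i j => M i.succ j.succ

/-- Array-backed storage of an `n × n` integer array (the recursion below must pass DATA, not closures: a closure-valued Schur step re-reads four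
entries of the previous level per entry and evaluates in time exponential in `n`). -/
def toArr (n : ℕ) (M : Fin n → Fin n → ℤ) : Array (Array ℤ) := Array.ofFn fun i : Fin n => Array.ofFn fun j : Fin n => M i j

/-- Entry read of the array storage (total, default `0`). -/
def getA (A : Array (Array ℤ)) (i j : ℕ) : ℤ := (A.getD i #[]).getD j 0

/-- Reading back a stored array. [formal bookkeeping] -/
theorem getA_toArr (n : ℕ) (M : Fin n → Fin n → ℤ) (i j : Fin n) : getA (toArr n M) i.val j.val = M i j := by
  simp [getA, toArr, Array.getD, Array.getElem_ofFn]

/-- The stored array as a function again equals the original. [formal bookkeeping] -/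
theorem ofArr_toArr (n : ℕ) (M : Fin n → Fin n → ℤ) : (fun i j : Fin n => getA (toArr n M) i.val j.val) = M :=
  funext fun i => funext fun j => getA_toArr n M i j

/-- ★ **PSD TEST IN DIMENSION `n`** on array storage (exact integers): positive pivot and recurse on the division-free Schur complement, or zero first
row/column and recurse on the minor. -/
def psdTestA : (n : ℕ) → Array (Array ℤ) → Bool
  | 0, _ => true
  | n + 1, A =>
      let M : Fin (n + 1) → Fin (n + 1) → ℤ := fun i j => getA A i.val j.val
      (decide (0 < M 0 0) && psdTestA n (toArr n (schurStep n M))) ||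
        (decide (∀ j : Fin (n + 1), M 0 j = 0) && decide (∀ i : Fin (n + 1), M i 0 = 0) && psdTestA n (toArr n (minorStep n M)))

/-- ★ The PSD test of a function-presented array. -/
def psdTestN (n : ℕ) (M : Fin n → Fin n → ℤ) : Bool := psdTestA n (toArr n M)

/-- Splitting the form at index `0`. [formal bookkeeping] -/
theorem qfN_succ (n : ℕ) (M : Fin (n + 1) → Fin (n + 1) → ℤ) (x : Fin (n + 1) → ℝ) :
    qfN (n + 1) M x = (M 0 0 : ℝ) * (x 0 * x 0) + x 0 * (∑ j : Fin n, (M 0 j.succ : ℝ) * x j.succ) +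
      x 0 * (∑ i : Fin n, (M i.succ 0 : ℝ) * x i.succ) + ∑ i : Fin n, ∑ j : Fin n, (M i.succ j.succ : ℝ) * (x i.succ * x j.succ) := by
  unfold qfN
  rw [Fin.sum_univ_succ]
  simp only [Fin.sum_univ_succ]
  have h1 : ∑ j : Fin n, (M 0 j.succ : ℝ) * (x 0 * x j.succ) = x 0 * ∑ j : Fin n, (M 0 j.succ : ℝ) * x j.succ := by
    rw [Finset.mul_sum]; exact Finset.sum_congr rfl fun j _ => by ring
  have h2 : ∑ i : Fin n, ((M i.succ 0 : ℝ) * (x i.succ * x 0) + ∑ j : Fin n, (M i.succ j.succ : ℝ) * (x i.succ * x j.succ)) =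
      x 0 * (∑ i : Fin n, (M i.succ 0 : ℝ) * x i.succ) + ∑ i : Fin n, ∑ j : Fin n, (M i.succ j.succ : ℝ) * (x i.succ * x j.succ) := by
    rw [Finset.sum_add_distrib, Finset.mul_sum]
    congr 1
    exact Finset.sum_congr rfl fun i _ => by ring
  rw [h1, h2]; ring

/-- The Schur-step form: `q_B(x′) = a·q_minor(x′) − (Σ_i M_{i0} x′_i)(Σ_j M_{0j} x′_j)`. [formal bookkeeping] -/
theorem qfN_schurStep (n : ℕ) (M : Fin (n + 1) → Fin (n + 1) → ℤ) (y : Fin n → ℝ) :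
    qfN n (schurStep n M) y = (M 0 0 : ℝ) * (∑ i : Fin n, ∑ j : Fin n, (M i.succ j.succ : ℝ) * (y i * y j)) -
      (∑ i : Fin n, (M i.succ 0 : ℝ) * y i) * (∑ j : Fin n, (M 0 j.succ : ℝ) * y j) := by
  unfold qfN schurStep
  push_cast
  rw [Finset.sum_mul_sum, Finset.mul_sum, ← Finset.sum_sub_distrib]
  refine Finset.sum_congr rfl fun i _ => ?_
  rw [Finset.mul_sum, ← Finset.sum_sub_distrib]
  exact Finset.sum_congr rfl fun j _ => by ring

/-- ★ **SOUNDNESS OF `psdTestN`**: a symmetric integer array that passes the test has a non-negative form. [folklore: `a·q(x) = (a x₀ + Σ_j M₀ⱼ x_j)² + q_B(x′)`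
for the Schur branch; induction on `n`] -/
theorem qfN_nonneg_of_psdTestA : ∀ (n : ℕ) (M : Fin n → Fin n → ℤ), (∀ i j, M i j = M j i) → psdTestA n (toArr n M) = true →
    ∀ x : Fin n → ℝ, 0 ≤ qfN n M x
  | 0, M, _, _, x => by simp [qfN]
  | n + 1, M, hsym, h, x => by
      have hsplit := qfN_succ n M x
      -- symmetry turns the third term into the second
      have hST : ∑ i : Fin n, (M i.succ 0 : ℝ) * x i.succ = ∑ j : Fin n, (M 0 j.succ : ℝ) * x j.succ :=
        Finset.sum_congr rfl fun i _ => by rw [hsym]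
      unfold psdTestA at h
      simp only [getA_toArr] at h
      rw [Bool.or_eq_true] at h
      rcases h with h | h
      · -- Schur branch
        rw [Bool.and_eq_true, decide_eq_true_eq] at h
        obtain ⟨ha, hB⟩ := h
        have hBsym : ∀ i j, schurStep n M i j = schurStep n M j i := by
          intro i j; simp only [schurStep]; rw [hsym i.succ j.succ, hsym i.succ 0, hsym 0 j.succ]; ring
        have hIH := qfN_nonneg_of_psdTestA n (schurStep n M) hBsym hB (fun i => x i.succ)
        rw [qfN_schurStep] at hIH
        have ha' : (0 : ℝ) < (M 0 0 : ℝ) := by exact_mod_cast ha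
        set a : ℝ := (M 0 0 : ℝ)
        set S : ℝ := ∑ j : Fin n, (M 0 j.succ : ℝ) * x j.succ
        set Q : ℝ := ∑ i : Fin n, ∑ j : Fin n, (M i.succ j.succ : ℝ) * (x i.succ * x j.succ)
        rw [hST] at hsplit hIH
        -- `a · qf = (a x₀ + S)² + (a Q − S²)`
        have hid : a * qfN (n + 1) M x = (a * x 0 + S) ^ 2 + (a * Q - S * S) := by rw [hsplit]; ring
        have hnn : 0 ≤ a * qfN (n + 1) M x := by rw [hid]; nlinarith [sq_nonneg (a * x 0 + S), hIH]
        by_contra hneg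
        have hlt := lt_of_not_ge hneg
        have := mul_neg_of_pos_of_neg ha' hlt
        linarith
      · -- zero row/column branch
        rw [Bool.and_eq_true, Bool.and_eq_true, decide_eq_true_eq, decide_eq_true_eq] at h
        obtain ⟨⟨hrow, hcol⟩, hmin⟩ := h
        have hMsym : ∀ i j, minorStep n M i j = minorStep n M j i := fun i j => hsym i.succ j.succ
        have hIH := qfN_nonneg_of_psdTestA n (minorStep n M) hMsym hmin (fun i => x i.succ)
        have h00 : (M 0 0 : ℝ) = 0 := by exact_mod_cast hrow 0
        have hS0 : ∑ j : Fin n, (M 0 j.succ : ℝ) * x j.succ = 0 :=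
          Finset.sum_eq_zero fun j _ => by rw [show (M 0 j.succ : ℝ) = 0 by exact_mod_cast hrow j.succ]; ring
        have hT0 : ∑ i : Fin n, (M i.succ 0 : ℝ) * x i.succ = 0 :=
          Finset.sum_eq_zero fun i _ => by rw [show (M i.succ 0 : ℝ) = 0 by exact_mod_cast hcol i.succ]; ring
        rw [hsplit, h00, hS0, hT0]
        have : qfN n (minorStep n M) (fun i => x i.succ) = ∑ i : Fin n, ∑ j : Fin n, (M i.succ j.succ : ℝ) * (x i.succ * x j.succ) := rfl
        linarith [hIH]

/-- ★ **SOUNDNESS OF `psdTestN`** (function-presented array). -/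
theorem qfN_nonneg_of_psdTestN (n : ℕ) (M : Fin n → Fin n → ℤ) (hsym : ∀ i j, M i j = M j i) (h : psdTestN n M = true) (x : Fin n → ℝ) :
    0 ≤ qfN n M x := qfN_nonneg_of_psdTestA n M hsym h x

/-! ## §2 Sign-vertex reduction in dimension `n` -/

/-- Perturbation bound: `|D| ≤ R` entrywise ⟹ `−Σ R_ij |x_i||x_j| ≤ Σ D_ij x_i x_j`. [folklore] -/
theorem quadForm_pert_geN {n : ℕ} (D R : Fin n → Fin n → ℝ) (hD : ∀ i j, |D i j| ≤ R i j) (x : Fin n → ℝ) :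
    -∑ i, ∑ j, R i j * (|x i| * |x j|) ≤ ∑ i, ∑ j, D i j * (x i * x j) := by
  rw [← Finset.sum_neg_distrib]
  refine Finset.sum_le_sum fun i _ => ?_
  rw [← Finset.sum_neg_distrib]
  refine Finset.sum_le_sum fun j _ => ?_
  have h1 : |D i j * (x i * x j)| ≤ R i j * (|x i| * |x j|) := by
    rw [abs_mul, abs_mul]; exact mul_le_mul_of_nonneg_right (hD i j) (by positivity)
  linarith [neg_abs_le (D i j * (x i * x j))]

/-- ★ **SIGN-VERTEX REDUCTION (dimension `n`)**: if every vertex array `C − (z zᵀ) ∘ R − κ·1`, `z ∈ {±1}ⁿ`, has non-negative form, then every `N` with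
`|N − C| ≤ R` entrywise has form `≥ κ‖x‖²`. [folklore: Rohn; verbatim the `Fin 3` proof of `…HomHertz`] -/
theorem quadForm_ge_of_signVerticesN {n : ℕ} (C R : Fin n → Fin n → ℝ) {κ : ℝ}
    (hV : ∀ z : Fin n → ℝ, (∀ i, z i = 1 ∨ z i = -1) →
      ∀ x : Fin n → ℝ, 0 ≤ ∑ i, ∑ j, (C i j - z i * z j * R i j - if i = j then κ else 0) * (x i * x j))
    (N : Fin n → Fin n → ℝ) (hN : ∀ i j, |N i j - C i j| ≤ R i j) (x : Fin n → ℝ) :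
    κ * ∑ i, x i ^ 2 ≤ ∑ i, ∑ j, N i j * (x i * x j) := by
  classical
  set z : Fin n → ℝ := fun i => if 0 ≤ x i then (1 : ℝ) else -1 with hz
  have hzs : ∀ i, z i = 1 ∨ z i = -1 := by intro i; simp only [hz]; split_ifs <;> simp
  have hzx : ∀ i, z i * x i = |x i| := by
    intro i; simp only [hz]; split_ifs with h
    · rw [abs_of_nonneg h]; ring
    · rw [abs_of_neg (lt_of_not_ge h)]; ring
  have hpert := quadForm_pert_geN (fun i j => N i j - C i j) R hN x
  have hvert := hV z hzs x
  have hsplit : ∑ i, ∑ j, N i j * (x i * x j) = ∑ i, ∑ j, C i j * (x i * x j) + ∑ i, ∑ j, (N i j - C i j) * (x i * x j) := by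
    rw [← Finset.sum_add_distrib]; refine Finset.sum_congr rfl fun i _ => ?_
    rw [← Finset.sum_add_distrib]; exact Finset.sum_congr rfl fun j _ => by ring
  -- expand the vertex form: C-part − R|x||x| − κΣx²
  have hvexp : ∑ i, ∑ j, (C i j - z i * z j * R i j - if i = j then κ else 0) * (x i * x j) =
      ∑ i, ∑ j, C i j * (x i * x j) - ∑ i, ∑ j, R i j * (|x i| * |x j|) - κ * ∑ i, x i ^ 2 := by
    have e1 : ∀ i j, (C i j - z i * z j * R i j - if i = j then κ else 0) * (x i * x j) =
        C i j * (x i * x j) - R i j * (|x i| * |x j|) - (if i = j then κ else 0) * (x i * x j) := by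
      intro i j; rw [← hzx i, ← hzx j]; ring
    have e2 : ∀ i, ∑ j, (if i = j then κ else 0) * (x i * x j) = κ * x i ^ 2 := by
      intro i
      rw [Finset.sum_eq_single i (fun j _ hji => by rw [if_neg (Ne.symm hji)]; ring) (fun hi => absurd (Finset.mem_univ i) hi)]
      rw [if_pos rfl]; ring
    simp only [e1, Finset.sum_sub_distrib, e2]
    congr 1
    rw [Finset.mul_sum]
  rw [hvexp] at hvert
  rw [hsplit]
  linarith

/-! ## §3 The kernel test in dimension `n` -/

/-- All `2ⁿ` integer sign vectors. -/
def signsN : (n : ℕ) → List (Fin n → ℤ)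
  | 0 => [fun _ => 1]
  | n + 1 => (signsN n).flatMap fun z => [Fin.cons 1 z, Fin.cons (-1) z]

/-- Every real sign vector is the cast of one of `signsN n`. [formal bookkeeping] -/
theorem exists_sign_castN : ∀ (n : ℕ) (z : Fin n → ℝ), (∀ i, z i = 1 ∨ z i = -1) → ∃ zI ∈ signsN n, ∀ i, z i = ((zI i : ℤ) : ℝ)
  | 0, z, _ => ⟨fun _ => 1, by simp [signsN], fun i => i.elim0⟩
  | n + 1, z, hz => by
      obtain ⟨zI, hmem, hzI⟩ := exists_sign_castN n (fun i => z i.succ) (fun i => hz i.succ)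
      rcases hz 0 with h0 | h0
      · refine ⟨Fin.cons 1 zI, ?_, ?_⟩
        · simp only [signsN, List.mem_flatMap]; exact ⟨zI, hmem, by simp⟩
        · intro i; refine Fin.cases ?_ (fun j => ?_) i
          · simp [h0]
          · simp [hzI j]
      · refine ⟨Fin.cons (-1) zI, ?_, ?_⟩
        · simp only [signsN, List.mem_flatMap]; exact ⟨zI, hmem, by simp⟩
        · intro i; refine Fin.cases ?_ (fun j => ?_) i
          · simp [h0]
          · simp [hzI j]

/-- Vertex array (scale `2·SC`): `C2 − (z zᵀ) ∘ R2 − [i=j]·2κS`. -/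
def vertexArrN {n : ℕ} (C2 R2 : Fin n → Fin n → ℤ) (κS : ℤ) (z : Fin n → ℤ) (i j : Fin n) : ℤ :=
  C2 i j - z i * z j * R2 i j - (if i = j then 2 * κS else 0)

/-- Symmetry test of an integer array. -/
def symTestN {n : ℕ} (V : Fin n → Fin n → ℤ) : Bool := decide (∀ i j, V i j = V j i)

/-- ★ **SIGN-VERTEX TEST IN DIMENSION `n`** on interval data (`E` encloses the matrix at scale `SC`, `W ≥ |P|·SC`, floor `κS/SC`). -/
def hertzTestN (n : ℕ) (E : Fin n → Fin n → FI) (W : Fin n → Fin n → ℤ) (κS : ℤ) : Bool :=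
  let C2A := toArr n fun i j => (E i j).lo + (E i j).hi
  let R2A := toArr n fun i j => (E i j).hi - (E i j).lo + 2 * W i j
  (signsN n).all fun z =>
    let VA := toArr n (vertexArrN (fun i j => getA C2A i.val j.val) (fun i j => getA R2A i.val j.val) κS z)
    symTestN (fun i j : Fin n => getA VA i.val j.val) && psdTestA n VA

/-- ★★ **SOUNDNESS OF `hertzTestN`**: `M_ij ∈ E_ij`, `|P_ij|·SC ≤ W_ij`, test passed ⟹ `(κS/SC)·Σ x_i² ≤ Σ (M + P)_ij x_i x_j`. [folklore chaining; verbatim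
the `Fin 3` proof of `…HomHertzKit.quadForm_ge_of_hertzTest`] -/
theorem quadForm_ge_of_hertzTestN {n : ℕ} {E : Fin n → Fin n → FI} {W : Fin n → Fin n → ℤ} {κS : ℤ} (h : hertzTestN n E W κS = true)
    {M P : Fin n → Fin n → ℝ} (hM : ∀ i j, FI.mem (M i j) (E i j)) (hP : ∀ i j, |P i j| * SC ≤ (W i j : ℝ)) (x : Fin n → ℝ) :
    (κS : ℝ) / SC * ∑ i, x i ^ 2 ≤ ∑ i, ∑ j, (M i j + P i j) * (x i * x j) := by
  have hS : (0 : ℝ) < SC := by norm_num [SC]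
  unfold hertzTestN at h
  simp only [getA_toArr] at h
  rw [List.all_eq_true] at h
  set C2 : Fin n → Fin n → ℤ := (fun i j => (E i j).lo + (E i j).hi) with hC2
  set R2 : Fin n → Fin n → ℤ := (fun i j => (E i j).hi - (E i j).lo + 2 * W i j) with hR2
  have key := quadForm_ge_of_signVerticesN (fun i j => (C2 i j : ℝ)) (fun i j => (R2 i j : ℝ)) (κ := 2 * (κS : ℝ)) ?_
    (fun i j => 2 * SC * (M i j + P i j)) ?_ x
  · have hsum : ∑ i, ∑ j, 2 * SC * (M i j + P i j) * (x i * x j) = 2 * SC * ∑ i, ∑ j, (M i j + P i j) * (x i * x j) := by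
      rw [Finset.mul_sum]
      refine Finset.sum_congr rfl fun i _ => ?_
      rw [Finset.mul_sum]
      exact Finset.sum_congr rfl fun j _ => by ring
    rw [hsum] at key
    rw [div_mul_eq_mul_div, div_le_iff₀ hS]
    nlinarith [key, Finset.sum_nonneg (fun i (_ : i ∈ (Finset.univ : Finset (Fin n))) => sq_nonneg (x i))]
  · intro z hz y
    obtain ⟨zI, hzI, hzc⟩ := exists_sign_castN n z hz
    have hb := h zI hzI
    simp only [Bool.and_eq_true] at hb
    have hsym : ∀ i j, vertexArrN C2 R2 κS zI i j = vertexArrN C2 R2 κS zI j i := by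
      have := of_decide_eq_true hb.1; exact this
    have hq := qfN_nonneg_of_psdTestA n _ hsym hb.2 y
    have hentry : ∀ i j, ((C2 i j : ℝ) - z i * z j * (R2 i j : ℝ) - if i = j then 2 * (κS : ℝ) else 0) =
        ((vertexArrN C2 R2 κS zI i j : ℤ) : ℝ) := by
      intro i j
      by_cases hij : i = j
      · simp only [vertexArrN, hzc i, hzc j, if_pos hij]; push_cast; ring
      · simp only [vertexArrN, hzc i, hzc j, if_neg hij]; push_cast; ring
    have hsum : ∑ i, ∑ j, ((C2 i j : ℝ) - z i * z j * (R2 i j : ℝ) - if i = j then 2 * (κS : ℝ) else 0) * (y i * y j) =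
        ∑ i, ∑ j, ((vertexArrN C2 R2 κS zI i j : ℤ) : ℝ) * (y i * y j) :=
      Finset.sum_congr rfl fun i _ => Finset.sum_congr rfl fun j _ => by rw [hentry i j]
    rw [hsum]
    exact hq
  · intro i j
    have hm := hM i j
    have hlo : ((E i j).lo : ℝ) ≤ M i j * SC := hm.1
    have hhi : M i j * SC ≤ ((E i j).hi : ℝ) := hm.2
    have habsP := abs_le.1 (show |P i j * SC| ≤ (W i j : ℝ) by rw [abs_mul, abs_of_pos hS]; exact hP i j)
    simp only [hC2, hR2]
    push_cast
    rw [abs_le]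
    constructor
    · linarith [habsP.1]
    · linarith [habsP.2]

end Summit.AtomisticToContinuum.Crystallization.Theorems.FrustratedLawDichotomyStrainedPatchHomHertzN
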